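import Mathlib
import HarnessLib
import HarnessLib.Audit
import Summits.CriticalPhenomena.Statement
import Literature.Probability.RandomPlanarGeometry.HexSAW
import Summits.CriticalPhenomena.SAWScalingLimit.Theorems.SAWMassiveIsingTiltHexEndpointApproxExists
import HarnessLib.Audit.Status.Attr

/-!
Route: SAWThetaPercolation

DORMANT since 2026-08-25T12:33:20Z (reconciler: no traction for 7.7 d (last activity item-evidence-added at 2026-08-17T19:14:41Z); parked, not closed — `ledger route dormant route-CriticalPhenomena-SAWThetaPercolation --off` to reactiva) — unstaffed, not closed; items shared with open routes are served there. `ledger route dormant <id> --off` reactivates.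

# Route SAWThetaPercolation — SLE(8/3) is SLE(6) with its pinch points priced out — enter at the
percolation Θ′ corner of the contact-fugacity family

It suffices to show X = PinchFreeSLE6 ∧ ThetaWindowLimit ∧ BelowThetaContinuity ∧
LatticeUniversality. On δHex take the CONTACT-FUGACITY
family 𝔓_{x,ω}(γ) ∝ x^{V(γ)} ω^{K(γ)}, V = vertices, K(γ) = V − N(γ), N = number of hexagons
bordering an edge of γ (so K counts the steps whose
newly met hexagon was met before: lattice self-contacts). ω = 1 is the hexagonal SAW law at fugacity
x EXACTLY; (x, ω) = (1/2, 2) weighs γ by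
2^{−N(γ)}, i.e. it is the full-plane critical site-percolation exploration path started at a and
conditioned to traverse Ω_δ to b — the
Coniglio–Jan–Majid–Stanley / Duplantier–Saleur Θ′ identity (ConiglioJanMajidStanley1987,
DuplantierSaleur1987; VernierJacobsenSaleur2015 §2,
Θ_DS = (K, τ) = (1/2, 2)) read at both ends. PinchFreeSLE6 (continuum): chordal SLE₆ conditioned to
have no double point of loop-diameter ≥ ε and
no wall contact ε-away from a, b converges to chordal SLE_{8/3} as ε → 0+ (locality ⇒ for every ε
the conditioned family is restriction-exact against hulls ε-away from a, b;
LawlerSchrammWerner2003_holds closes once covariance of the limit is known). ThetaWindowLimit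
(lattice → continuum): along some schedule ω(δ) ↑ 2,
x(δ) (the near-Θ′ window; crossover exponent 3/4 = dimension of interface pivotals = of SLE₆ double
points) the contact-fugacity interfaces
converge to the same pinch-free limit. BelowThetaContinuity: that conclusion propagates to every
fixed ω ∈ [1, 2) with x_c(1) = 1/√(2+√2) (target
OneClassBelowTheta, which contains Duminil-Copin–Smirnov Conjecture 1 at ω = 1). LatticeUniversality
(shared stmt-CriticalPhenomena-0807) carries
Hex to δℤ².
Lean: `PinchFreeSLE6 ∧ ThetaWindowLimit ∧ BelowThetaContinuity ∧ LatticeUniversality`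

## Assembly
The deciding theorem is CRUX-ONLY: `closes : PinchFreeSLE6 → ThetaWindowLimit → BelowThetaContinuity
→ LatticeUniversality → SAWScalingLimit`
(certified, gate-native, rev 10) does the route-specific bookkeeping itself — ThetaWindowLimit gives
P, the ε-limits μ_ε → P(D) (with an SLE₆ law μ
per domain) and a window schedule with 𝔓_{x(δ),ω(δ)} → P(D); PinchFreeSLE6 gives μ_ε → SLE_{8/3};
uniqueness of limits of real nets along 𝓝[>]0
(tendsto_nhds_unique, test function by test function) identifies ∫ f dP(D) = 𝔼 f(Γ) for the
SLE_{8/3} curve Γ, so the window laws converge to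
SLE_{8/3} (measurability is automatic on the discrete σ-algebra); BelowThetaContinuity turns this
into the target OneClassBelowTheta; the frame
statement Assembly : OneClassBelowTheta → LatticeUniversality → SAWScalingLimit (target + shared
transfer crux ⇒ Statement) is then PROVED INSIDE
`closes` (not a hypothesis) and applied: at ω = 1, 1^K = 1 makes 𝔓_{x,1} the fugacity-x hexagonal
law definitionally (one_pow, mul_one) and
xc 1 = hexCriticalFugacity makes it hexSAWLaw; hexagonal companion endpoints exist for every
Dobrushin domain (landed
Theorems.HexEndpointApprox.exists_isEmbEndpointApprox, imported from
Theorems.SAWMassiveIsingTiltHexEndpointApproxExists — the content of the former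
support HexEndpointApproxExists); LatticeUniversality + Tendsto.add transfer the limit to SAW.law on
δℤ² (two-ε argument), i.e. SAWScalingLimit.
The assembly item itself stays an open PROVABLE-NOW item for provers (hand-off proof
AssemblyProofG4.lean attached to stmt-CriticalPhenomena-18043,
lean check rc 0, 0 sorries).

Rationale: WHY THIS LINE. Critical percolation is the one exactly solved c = 0 neighbour of the self-avoiding
walk (κ = 6 and κ = 8/3 are Duplantier-dual, κκ′ = 16, both
at central charge 0), its interface limit SLE₆ is a theorem on this very lattice (Smirnov2001,
CamiaNewman2007; in tree as the named fact
convergesInLawToSLE_six_triInterface) and no open route uses it: the solved corners in play are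
Brownian (SAWCutPointCondensation,
SAWRingGibbsDescent, SAWFrontierHomotopy), Ising (SAWMassiveIsingTilt, SAWLoopFugacityFlow) and LERW
(SAWChargeContinuation). The bridge is an
exact lattice identity, not an analogy: the hexagonal SAW and the percolation exploration path are
the ω = 1 and ω = 2 members of ONE nearest-
neighbour Gibbs family (the Θ′/VISAW family of the polymer-collapse literature, Θ_DS tricritical,
ν_Θ = 4/7, φ = 3/7), so the SAW is the
percolation exploration chain killed at its contacts with its own past, i.e. SLE₆ with its pinch
points priced out; the continuum shadow is a
conditioning theorem for SLE₆ in the spirit of LawlerSchrammWerner2003Restriction §9.5 (SLE₆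
conditioned not to touch the boundary fills like the
Brownian excursion, P₁) and Werner2005ConformalRestriction Thm 2/4 (the only restriction measure on
simple curves is SLE_{8/3}), where locality of
SLE₆ (LawlerSchrammWerner2001, in tree as IsSLELaw.locality_six) hands exact restriction (against
hulls ε-away from the marked points) to every conditioned family for free and the
whole difficulty is the cutoff-universality of the ε → 0 limit — a special, explicit case of the
restriction–Markov rigidity R* of route
SAWRestrictionRigidity with Itô calculus on √6·B available. Imported: near-critical percolation
technology (GarbanPeteSchramm2013Pivotal,
GarbanPeteSchramm2018: pivotal measures, stability, window scaling |p − p_c| ≍ δ^{3/4} ↔ here 2 − ω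
≍ δ^{3/4}), SLE₆ locality and LSW
conditioning, the Θ-point physics (DuplantierSaleur1987, BloteNienhuis1989,
VernierJacobsenSaleur2015), and for the infrared end the
mating-of-trees description of SLE₆ bubbles (DuplantierMillerSheffield2021 Thm 1.18–1.19: 3/2-stable
boundary lengths; pricing out pinches =
thinning the jumps). Against the negatives index: no all-δ tightness (stmt-0772) — every quantifier
is along 𝓝[>]0; no observable, so stmt-5420/8312
are not touched.

RANKED CRUXES. #0 OneClassBelowTheta (target) — there is a critical fugacity curve xc on [1,2) with
xc(1) = 1/√(2+√2) such that for every ω ∈ [1,2), every Dobrushin domain and every hexagonal endpoint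
approximation the contact-fugacity interface law 𝔓_{xc(ω),ω} on δHex converges in law (curves modulo
reparametrisation) to chordal SLE_{8/3}; at ω = 1 this is Duminil-Copin–Smirnov Conjecture 1. (why
it might fail: it contains DCS Conjecture 1 at ω = 1; for ω ∈ (1,2) an unexpected multicritical
point or a first-order stretch of x_c(ω) below Θ_DS would break it (DS89/VJS15 numerics say no).)
[DuminilCopinSmirnov2012, DuplantierSaleur1987, VernierJacobsenSaleur2015,
LawlerSchrammWerner2004SAW]
#2 PinchFreeSLE6 (crux) — PINCH-FREE SLE₆ IS SLE_{8/3} (continuum, new): for every Dobrushin domain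
(D; a, b) and every chordal SLE₆ law μ on D, the laws μ_ε := μ conditioned on E_ε = {no double point
γ(s) = γ(t), s < t, with diam γ[s,t] ≥ ε} ∩ {range ∩ ∂D ⊆ B(a,ε) ∪ B(b,ε)} converge in law to
chordal SLE_{8/3} in D as ε → 0+. Mechanism: E_ε is intrinsic and SLE₆ a.s. crosses any interior arc
it touches, so locality makes D ↦ μ_ε restriction-EXACT for each ε against hull subdomains whose cut
is ε-away from a, b (exact restriction in the limit); Euclidean cutoff ⇒ rotation/translation
symmetric, reversible; simple and wall-avoiding in the limit; the one real input is conformal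
covariance of the limit (cutoff universality), then LawlerSchrammWerner2003_holds. [difficulty:
open-problem] (why it might fail: Borel–Kolmogorov: the Euclidean ε-cutoff may select a
restriction-exact, scale-invariant but NOT conformally covariant limit (a counterexample to R*), or
μ_ε may fail to be tight / lose mass to degenerate chords as ε → 0.)
[LawlerSchrammWerner2003Restriction, Werner2005ConformalRestriction, LawlerSchrammWerner2001,
Dubedat2005, GarbanPeteSchramm2013Pivotal, DuplantierMillerSheffield2021]
#3 ThetaWindowLimit (crux) — THE NEAR-Θ′ WINDOW UNPINCHES TO THE SAME LIMIT (lattice → continuum):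
there are a chordal family P, a schedule ω(δ) → 2 with ω(δ) < 2 eventually and fugacities x(δ) such
that (i) in every Dobrushin domain the ε-conditioned SLE₆ laws of PinchFreeSLE6 converge to P(D) as
ε → 0+, and (ii) for every Dobrushin domain and hexagonal endpoint approximation the
contact-fugacity interface laws 𝔓_{x(δ),ω(δ)} converge in law to P(D) as δ → 0+. Intended proof: the
(1/2, 2) corner is the boundary-free critical exploration path conditioned to traverse Ω_δ (exact
identity; limit = SLE₆ conditioned off the wall, filling P₁, by Camia–Newman + boundary-arm ratio
limits), contacts along the interface are its pivotal hexagons, and in the window 2 − ω ≍ λδ^{3/4}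
the tilt ω^K x^V is a GPS-type perturbation by the renormalised interface-pivotal measure whose λ →
∞ end prices out every macroscopic pinch. [deps: PinchFreeSLE6] [difficulty: open-problem] (why it
might fail: soft vs hard: the lattice prices contacts by a factor, the continuum conditions on E_ε —
two approximations of the null event 'γ simple' that may disagree (Borel–Kolmogorov); and the
annealed tilt is no i.i.d. perturbation: GPS stability must absorb the δ^(−1/8) contact noise into
x(δ).) [GarbanPeteSchramm2013Pivotal, GarbanPeteSchramm2018, CamiaNewman2007, Smirnov2001,
ConiglioJanMajidStanley1987, DuplantierSaleur1987, Nolin2008]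
#4 BelowThetaContinuity (crux) — NO TRANSITION BELOW Θ′: if along some schedule ω(δ) ↑ 2, x(δ) the
contact-fugacity interfaces converge to chordal SLE_{8/3} in every Dobrushin domain, then
OneClassBelowTheta holds — the SLE_{8/3} limit propagates from the window to every fixed contact
fugacity ω ∈ [1,2) along the critical curve, down to the SAW at (1/√(2+√2), 1) (irrelevance of the
contact operator at the dilute fixed point: Cov_ω(macroscopic event, K − c(ω)V) → 0 for ω < 2).
[deps: ThetaWindowLimit] [difficulty: XL] (why it might fail: universality along a critical line
with no monotone coupling in ω: an intermediate multicritical point on (1,2), a first-order piece of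
x_c(ω), or non-commuting limits (δ → 0, ω ↑ 2) vs ω ↓ 1 would break the propagation; no rigorous
irrelevance argument exists at a non-Gaussian fixed point.) [DuplantierSaleur1987,
BloteNienhuis1989, VernierJacobsenSaleur2015, DuminilCopinKozmaYadin2014, GlazmanManolescu2019]
#5 LatticeUniversality (crux) — the shared Hex → ℤ² transfer (stmt-CriticalPhenomena-0807,
verbatim): for every Dobrushin domain, δℤ² endpoint approximation (a,b) and hexagonal one (a′,b′),
and every bounded continuous f on CurveClass ℂ, ∫ f∘curve dP^(ℤ²)_δ − ∫ f∘curve dP^(Hex)_δ → 0 as δ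
→ 0+. [difficulty: open-problem] (why it might fail: universality across lattices for the SAW is
open even at the level of exponents; Yang–Baxter track exchange (Glazman–Manolescu) controls
boundary two-point functions only, not curve laws.) [GlazmanManolescu2019, DuminilCopinSmirnov2012,
LawlerSchrammWerner2004SAW]
(dropped at rev 8, formerly #9 support) HexEndpointApproxExists — every Dobrushin domain with a δℤ²
endpoint approximation admits a hexagonal endpoint approximation; PROVED in tree
(Theorems.HexEndpointApprox.exists_isEmbEndpointApprox, and hexEndpointApproxExists for the shared
stmt-CriticalPhenomena-9864), no longer a hypothesis of `closes` and no longer an item of this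
route: the landed theorem is invoked inside the proof of the assembly item, which is where the Hex →
ℤ² endpoint bookkeeping now lives. [DuminilCopinSmirnov2012]
#1 Assembly (assembly) — the frame statement OneClassBelowTheta → LatticeUniversality →
SAWScalingLimit (target + shared transfer crux ⇒ Statement): PROVED INSIDE the crux-only `closes`
(rev 10; not a hypothesis) and kept as an open provable-now item for provers (ω = 1 specialisation
one_pow/mul_one/xc 1 = x_c(ℍ); hexagonal companion endpoints from the landed
Theorems.HexEndpointApprox.exists_isEmbEndpointApprox; two-ε transfer by LatticeUniversality +
Tendsto.add — hand-off proof AssemblyProofG4.lean attached to stmt-CriticalPhenomena-18043, rc 0).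
[difficulty: provable-now] [DuminilCopinSmirnov2012, LawlerSchrammWerner2004SAW]

TWO-LAYER PLAN. Foreseen glued splits (registered as birth skeletons, not filed): PinchFreeSLE6 ⇐
PinchFreeLimit (ε-limit exists, restriction-exact by locality,
simple, wall-avoiding) → PinchFreeCovariant (cutoff universality) → PinchFreeSLE6 [via
LawlerSchrammWerner2003_holds, composition proved];
ThetaWindowLimit ⇐ PinchFreeLimitExists → CornerLimit ((1/2,2) member → wall-free SLE₆) →
UnpinchingWindow → ThetaWindowLimit;
BelowThetaContinuity ⇐ WindowToInterval (leave the window to fixed ω ∈ [ω₀,2)) → IntervalToAll (no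
multicritical point down to ω = 1) → BelowThetaContinuity.

KILL CRITERIA. A restriction-exact but non-conformally-covariant ε → 0 limit of conditioned SLE₆
(¬PinchFreeSLE6) kills the route outright AND refutes R* of
SAWRestrictionRigidity — close `refuted:PinchFreeSLE6` and hand the witness to the rigidity routes.
Numerical ν(ω) ≠ 3/4 for some ω ∈ (1,2) on
the hexagonal contact family (or a first-order stretch of x_c(ω)) refutes
BelowThetaContinuity/OneClassBelowTheta — pivot to the VISAW (p,τ)
surface entering at Θ_BN, or close. ThetaWindowLimit refuted with PinchFreeSLE6 standing ⇒ the
window schedule exists only for the soft tilt —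
restate with the soft family. HexSAWScalingLimit proved elsewhere moots cruxes 2–4;
LatticeUniversality refuted moots every Hex-anchored route.

NOT DECOMPOSED YET. The corner limit itself ((1/2,2) member = exploration conditioned off the wall →
SLE₆(2;2)-type law with filling P₁; needs boundary two-arm ratio
limits), the renormalisation of the contact count into x(δ) (cumulants of the microscopic contact
noise, order δ^(−1/4) per natural length), the
choice soft tilt vs hard conditioning in the continuum, positivity/measurability bookkeeping of E_ε
(support theorem for SLE₆: E_ε has positive
mass for every ε), and the bulk-started endpoints allowed by IsEmbEndpointApprox — all layer-2
children.

CHEAPEST FALSIFIER. (i) Lookup: is 'SLE₆ conditioned to be simple (ε-regularised) → SLE_{8/3}'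
settled in print either way? Searched (LSW03 §9.5 does the wall-only
conditioning; Werner05 remarks on intrinsic measures with double points; galaxy/arXiv 'SLE
conditioned simple / no double points': 0 rows) —
not found. (ii) Lattice Monte-Carlo, one kit job: percolation exploration on δHex in the half-strip,
importance-sampled by ω^K at ω = 1.5 and
conditioned on no ε-pinch, against the 5/8 restriction formula P(γ avoids A) = Φ′_A(0)^(5/8) for
slit hulls A; and ν(ω) at ω ∈ {1.25, 1.5, 1.75}
(DS89 report ν ≈ 3/4 below Θ′). (iii) In Lean now (bc/special.lean, rc 0): the ω = 1 member IS
embLaw (one_pow) and (1/2)^V·2^(V−N) = 2^(−N).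

NUMBERS. x_c(Hex) = 1/√(2+√2) = 0.5412 (DuminilCopinSmirnov2012); Θ_DS corner (x, ω) = (1/2, 2) with
ν_Θ = 4/7, γ_Θ = 8/7, φ_Θ = 3/7 (DuplantierSaleur1987;
VernierJacobsenSaleur2015 eq. (expoDS), K_DS = 1/2, τ_DS = 2); SAW: ν = 3/4, restriction exponent
5/8; crossover/window exponent: interface-
pivotal dimension 3/4 = 2 − 5/4 (4-arm), SLE₆ double points dim 3/4, SLE₆ ∩ ∂ dim 2/3; P₁ = filling
of SLE₆ conditioned off the wall
(LawlerSchrammWerner2003Restriction §9.5). Items at open: 7 (1 target, 4 cruxes incl. 1 shared, 1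
proved support, 1 assembly); items now: 6 (support HexEndpointApproxExists dropped at rev 8, proved
in tree), all 6 in the cone of `closes`.

DEFINITION REQUESTS. None blocking: the contact-fugacity law, the pinch/wall-free event and the
conditioned measure are inlined `let`s over HexDomainSAW,
hexFaceVertices, CurveClass.mk/range, IsSLELaw, TendstoLaw, ConvergesInLawToSLE. Optional later (to
shorten signatures): `contactCount`,
`isawLaw` in HexSAW.lean; `CurveClass.pinchFree ε`, `condLaw μ S` in CurveSpace.lean.

Novelty: Searches (2026-08-17): `lit search --source s2 "SLE conditioned to be simple restriction"` (4:
LSW03, SheffieldWerner CLE, MillerWerner; none on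
pinch-conditioning); `--source arxiv/crossref "theta point ... percolation hull / Duplantier Saleur
1987"` (DS87 doi:10.1103/physrevlett.59.539,
replies 1988/89); `--source arxiv "collapse two-dimensional polymers Vernier Jacobsen Saleur"`
(arXiv:1505.07007, read pp. 3–6: Θ_DS =
percolation via ñ = n+1); `lit read arxiv:math/0209343 --grep condition` (§9.5 read); `lit read
arxiv:math/0307353` (Thm 2, Thm 4, §1.4 read);
`lit read arxiv:1409.7055 --grep stable` (Thm 16–19, Cor 20 read); `lit search --hybrid "mating of
trees stable ... kappa prime"` (local 12);
`lit galaxy search --star all "conditioned to have no double points" / "smart kinetic walk"` (0/0);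
grep of all 67 Theses for
percolation/pivotal/Θ′ (Θ′ appears only as a failure mode of SAWMassiveIsingTilt; pivotal only in
SAWCircleScreening's sources);
`ledger negatives --problem CriticalPhenomena` (11; none near).
Nearest prior art found: route SAWMassiveIsingTilt (same typed shell — a two-parameter interface
family on Hex with a solved corner, a window
crux and a curve-continuity crux — entering at the Ising corner with restriction produced by MASS)
and route SAWCutPointCondensation (a relevant
y = 3/4 flow from the Brownian excursion to SLE_{8/3} as infrared end); in print
DuplantierSaleur1987 / ConiglioJanMajidStanley1987 /
VernierJacobsenSaleur2015 (the Θ′ = percolation id  [refs: 10.1103/physrevlett.59.539, 1505.07007, math/0209343, math/0307353, 1409.7055, doi:10.1103/physrevlett.59.539, arxiv:math/0209343, arxiv:math/0307353, arxiv:1409.7055, DuplantierSaleur1987, ConiglioJanMajidStanley1987, VernierJacobsenSaleur2015]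

Barriers (technique_class: percolation-theta-corner, conditioned-sle6, contact-flow): - technique_class: percolation-theta-corner, conditioned-sle6, contact-flow
- Literature.Barriers.CriticalPhenomena.SAWNotKineticallyGrown: the corner IS a kinetically grown,
local (κ = 6) process and the barrier's theorem (consistent local growth ⇒ locality ⇒ κ = 6) is
exactly why the SAW must appear as a KILLED/conditioned version of it: the contact tilt ω^K is a
Gibbs weight on whole paths, the tilted family is not consistent in Lawler's sense (6.8), and its
limit is singular w.r.t. SLE₆ (κ changes from 6 to 8/3) — the line lives off the kinetic class by
construction.
- Literature.Barriers.CriticalPhenomena.SupercriticalSAWSpaceFilling: respected — every lattice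
statement is at the tuned fugacity x_c(ω) (existential xc, x(δ)); ω > 2 (collapsed) and x > x_c(ω)
(dense, DKY) are outside all items.
- Literature.Barriers.CriticalPhenomena.ParafermionicHalfCauchyRiemann: not engaged — no observable,
no discrete holomorphicity; conformal input comes from Smirnov's theorem at the corner and from SLE₆
in the continuum crux.
- Literature.Barriers.CriticalPhenomena.NienhuisWeightsExcludeVertexSAW: not engaged on Hex; the ℤ²
statement is reached through the shared LatticeUniversality, not through integrable weights.
- Literature.Barriers.CriticalPhenomena.EmbeddingModulusUniqueness: not embedding-blind — conformal
invariance is imported from the equilateral triangular embedding (Smirnov) and from SLE₆; the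
cutoff-universality crux is stated for the Euclidean cutoff of that embedding.

History (route lifecycle, newest last):
- 2026-08-17T10:19:47Z · rev 6: restated Assembly (stmt-CriticalPhenomena-17999) — route-repair g2, BC6 `Assembly` unaccounted (gate refused retriage→aside and drop for the assembly item; its own hint: --restate Assembly): RESTATE Assembly to (planner-rbadge-CriticalPhenomena-SAWThetaPerco-1cff4865-g2-0)
- 2026-08-17T10:59:36Z · rev 7: restated Assembly (stmt-CriticalPhenomena-18021) — route-repair g3 (bc6 Assembly unaccounted = not a consumed binder of closes since rev 3): restate Assembly to the frame statement target+transfer ⇒ Statement (O (planner-rbadge-CriticalPhenomena-SAWThetaPerco-1cff4865-g3-0)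
- 2026-08-17T11:02:01Z · rev 8: dropped HexEndpointApproxExists — route-repair g3: drop HexEndpointApproxExists (stmt-CriticalPhenomena-17998) — proved in tree as Theorems.HexEndpointApprox.exists_isEmbEndpointApprox / hexEndp (planner-rbadge-CriticalPhenomena-SAWThetaPerco-1cff4865-g3-0)
- 2026-08-25T12:33:20Z · DORMANT — reconciler: no traction for 7.7 d (last activity item-evidence-added at 2026-08-17T19:14:41Z); parked, not closed — `ledger route dormant route-CriticalPhenomen (operator:999:3808853)

sub-problem: SAWScalingLimit · status: dormant · opened planner-plan-novel-CriticalPhenomena-SAWScaling-8a38611a-v2-g22-0 2026-08-17T08:40:55Z · rev 18 · ledger route-CriticalPhenomena-SAWThetaPercolation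
GENERATED by the gate from the ledger (D-0016/17). Provers cite these decls: `theorem foo : Summit.CriticalPhenomena.SAWScalingLimit.Theses.SAWThetaPercolation.<Decl> := …` in Summits/CriticalPhenomena/SAWScalingLimit/Theorems/<Name>.lean.
-/

namespace Summit.CriticalPhenomena.SAWScalingLimit.Theses.SAWThetaPercolation

open scoped BigOperators Topology Manifold Classical MeasureTheory ProbabilityTheory Matrix InnerProductSpace ComplexConjugate ContinuousMap
open Filter Set Function TopologicalSpace MeasureTheory

attribute [summit_statement] _root_.SAWScalingLimit

/-- item stmt-CriticalPhenomena-17994 · target · rank 0 · open · by planner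
why it might fail: it contains DCS Conjecture 1 at ω = 1; for ω ∈ (1,2) an unexpected multicritical point or a first-order stretch of x_c(ω) below Θ_DS would break it (DS89/VJS15 numerics say no).
sources: DuminilCopinSmirnov2012, DuplantierSaleur1987, VernierJacobsenSaleur2015, LawlerSchrammWerner2004SAW
[target] there is a critical fugacity curve xc on [1,2) with xc(1) = 1/√(2+√2) such that for every ω
∈ [1,2), every Dobrushin domain and every hexagonal endpoint approximation the contact-fugacity
interface law 𝔓_{xc(ω),ω} on δHex converges in law (curves modulo reparametrisation) to chordal
SLE_{8/3}; at ω = 1 this is Duminil-Copin–Smirnov Conjecture 1. -/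
@[route_item "route-CriticalPhenomena-SAWThetaPercolation"]
def OneClassBelowTheta : Prop :=
  let isawLaw : (Ω : Set ℂ) → (δ x ω : ℝ) → (a b : Literature.Probability.LatticeModels.HexVertex) → MeasureTheory.Measure (Literature.Probability.RandomPlanarGeometry.SAW.HexDomainSAW Ω δ a b) := fun Ω δ x ω a b => let w : MeasureTheory.Measure (Literature.Probability.RandomPlanarGeometry.SAW.HexDomainSAW Ω δ a b) := MeasureTheory.Measure.sum (fun γ : Literature.Probability.RandomPlanarGeometry.SAW.HexDomainSAW Ω δ a b => ENNReal.ofReal (x ^ γ.vertexCount * ω ^ (γ.vertexCount - (γ.walk.darts.toFinset.biUnion (fun d => Literature.Probability.LatticeModels.hexFaceVertices d.fst ∩ Literature.Probability.LatticeModels.hexFaceVertices d.snd)).card)) • MeasureTheory.Measure.dirac γ); (w Set.univ)⁻¹ • w; ∃ xc : ℝ → ℝ, xc 1 = Literature.Probability.RandomPlanarGeometry.SAW.hexCriticalFugacity ∧ ∀ ω ∈ Set.Ico (1 : ℝ) 2, ∀ (D : Literature.Probability.RandomPlanarGeometry.DobrushinDomain) (a b : ℝ → Literature.Probability.LatticeModels.HexVertex),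 Literature.Probability.RandomPlanarGeometry.SAW.IsEmbEndpointApprox Literature.Probability.LatticeModels.hexGraph Literature.Probability.LatticeModels.hexCenter D a b → Literature.Probability.RandomPlanarGeometry.ConvergesInLawToSLE ((8 : NNReal) / 3) D (fun δ (γ : Literature.Probability.RandomPlanarGeometry.SAW.HexDomainSAW D.carrier δ (a δ) (b δ)) => γ.curve) (fun δ => isawLaw D.carrier δ (xc ω) ω (a δ) (b δ))

/-- item stmt-CriticalPhenomena-17995 · crux · rank 2 · open · by planner
why it might fail: Borel–Kolmogorov: the Euclidean ε-cutoff may select a restriction-exact, scale-invariant but NOT conformally covariant limit (a counterexample to R*), or μ_ε may fail to be tight / lose mass to degenerate chords as ε → 0.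
sources: LawlerSchrammWerner2003Restriction, Werner2005ConformalRestriction, LawlerSchrammWerner2001, Dubedat2005, GarbanPeteSchramm2013Pivotal, DuplantierMillerSheffield2021
[crux] PINCH-FREE SLE₆ IS SLE_{8/3} (continuum, new): for every Dobrushin domain (D; a, b) and every
chordal SLE₆ law μ on D, the laws μ_ε := μ conditioned on E_ε = {no double point γ(s) = γ(t), s < t,
with diam γ[s,t] ≥ ε} ∩ {range ∩ ∂D ⊆ B(a,ε) ∪ B(b,ε)} converge in law to chordal SLE_{8/3} in D as
ε → 0+. Mechanism: E_ε is intrinsic, so SLE₆ locality makes the family D ↦ μ_ε restriction-EXACT for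
each ε; Euclidean cutoff ⇒ rotation/translation symmetric, reversible; simple and wall-avoiding in
the limit; the one real input is conformal covariance of the limit (cutoff universality), then
LawlerSchrammWerner2003_holds. [difficulty: open-problem] -/
@[route_item "route-CriticalPhenomena-SAWThetaPercolation", crux]
def PinchFreeSLE6 : Prop :=
  let good : ℝ → Literature.Probability.RandomPlanarGeometry.DobrushinDomain → Set (Literature.Probability.RandomPlanarGeometry.CurveClass ℂ) := fun ε D => {c | (∀ γ : Literature.Probability.RandomPlanarGeometry.Curve ℂ, Literature.Probability.RandomPlanarGeometry.CurveClass.mk γ = c → ∀ s t : unitInterval, s < t → γ s = γ t → Metric.diam (γ '' Set.Icc s t) < ε) ∧ c.range ∩ frontier D.carrier ⊆ Metric.ball (D.pt 0) ε ∪ Metric.ball (D.pt 1) ε}; let cond : MeasureTheory.Measure (Literature.Probability.RandomPlanarGeometry.CurveClass ℂ) → Set (Literature.Probability.RandomPlanarGeometry.CurveClass ℂ) → MeasureTheory.Measure (Literature.Probability.RandomPlanarGeometry.CurveClass ℂ) := fun μ S => (μ S)⁻¹ • μ.restrict S; ∀ (D : Literature.Probability.RandomPlanarGeometry.DobrushinDomain)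 (μ : MeasureTheory.Measure (Literature.Probability.RandomPlanarGeometry.CurveClass ℂ)), Literature.Probability.RandomPlanarGeometry.IsSLELaw 6 D μ → Literature.Probability.RandomPlanarGeometry.ConvergesInLawToSLE ((8 : NNReal) / 3) D (Ωδ := fun _ => Literature.Probability.RandomPlanarGeometry.CurveClass ℂ) (fun _ c => c) (fun ε => cond μ (good ε D))

/-- item stmt-CriticalPhenomena-17996 · crux · rank 3 · open · by planner
why it might fail: soft vs hard: the lattice prices contacts by a factor, the continuum conditions on E_ε — two approximations of the null event 'γ simple' that may disagree (Borel–Kolmogorov); and the annealed tilt is no i.i.d. perturbation: GPS stability must absorb the δ^(−1/8) contact noise into x(δ).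
sources: GarbanPeteSchramm2013Pivotal, GarbanPeteSchramm2018, CamiaNewman2007, Smirnov2001, ConiglioJanMajidStanley1987, DuplantierSaleur1987
[crux] THE NEAR-Θ′ WINDOW UNPINCHES TO THE SAME LIMIT (lattice → continuum): there are a chordal
family P, a schedule ω(δ) → 2 with ω(δ) < 2 eventually and fugacities x(δ) such that (i) in every
Dobrushin domain the ε-conditioned SLE₆ laws of PinchFreeSLE6 converge to P(D) as ε → 0+, and (ii)
for every Dobrushin domain and hexagonal endpoint approximation the contact-fugacity interface laws
𝔓_{x(δ),ω(δ)} converge in law to P(D) as δ → 0+. Intended proof: the (1/2, 2) corner is the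
boundary-free critical exploration path conditioned to traverse Ω_δ (exact identity; limit = SLE₆
conditioned off the wall, filling P₁, by Camia–Newman + boundary-arm ratio limits), contacts along
the interface are its pivotal hexagons, and in the window 2 − ω ≍ λδ^{3/4} the tilt ω^K x^V is a
GPS-type perturbation by the renormalised interface-pivotal measure whose λ → ∞ end prices out every
macroscopic pinch. [deps: PinchFreeSLE6] [difficulty: open-problem] -/
@[route_item "route-CriticalPhenomena-SAWThetaPercolation", crux]
def ThetaWindowLimit : Prop :=
  let isawLaw : (Ω : Set ℂ) → (δ x ω : ℝ) → (a b : Literature.Probability.LatticeModels.HexVertex) → MeasureTheory.Measure (Literature.Probability.RandomPlanarGeometry.SAW.HexDomainSAW Ω δ a b) := fun Ω δ x ω a b => let w : MeasureTheory.Measure (Literature.Probability.RandomPlanarGeometry.SAW.HexDomainSAW Ω δ a b) := MeasureTheory.Measure.sum (fun γ : Literature.Probability.RandomPlanarGeometry.SAW.HexDomainSAW Ω δ a b => ENNReal.ofReal (x ^ γ.vertexCount * ω ^ (γ.vertexCount - (γ.walk.darts.toFinset.biUnion (fun d => Literature.Probability.LatticeModels.hexFaceVertices d.fst ∩ Literature.Probability.LatticeModels.hexFaceVertices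 d.snd)).card)) • MeasureTheory.Measure.dirac γ); (w Set.univ)⁻¹ • w; let good : ℝ → Literature.Probability.RandomPlanarGeometry.DobrushinDomain → Set (Literature.Probability.RandomPlanarGeometry.CurveClass ℂ) := fun ε D => {c | (∀ γ : Literature.Probability.RandomPlanarGeometry.Curve ℂ, Literature.Probability.RandomPlanarGeometry.CurveClass.mk γ = c → ∀ s t : unitInterval, s < t → γ s = γ t → Metric.diam (γ '' Set.Icc s t) < ε) ∧ c.range ∩ frontier D.carrier ⊆ Metric.ball (D.pt 0) ε ∪ Metric.ball (D.pt 1) ε}; let cond : MeasureTheory.Measure (Literature.Probability.RandomPlanarGeometry.CurveClass ℂ) → Set (Literature.Probability.RandomPlanarGeometry.CurveClass ℂ) → MeasureTheory.Measure (Literature.Probability.RandomPlanarGeometry.CurveClass ℂ) := fun μ S => (μ S)⁻¹ • μ.restrict S; ∃ P : Literature.Probability.RandomPlanarGeometry.DobrushinDomain → MeasureTheory.Measure (Literature.Probability.RandomPlanarGeometry.CurveClass ℂ), (∀ D : Literature.Probability.RandomPlanarGeometry.DobrushinDomain, ∃ μ : MeasureTheory.Measure (Literature.Probability.RandomPlanarGeometry.CurveClass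 ℂ), Literature.Probability.RandomPlanarGeometry.IsSLELaw 6 D μ ∧ Literature.Probability.RandomPlanarGeometry.TendstoLaw (Ωδ := fun _ => Literature.Probability.RandomPlanarGeometry.CurveClass ℂ) (fun _ c => c) (fun ε => cond μ (good ε D)) id (P D)) ∧ ∃ ωs xs : ℝ → ℝ, Filter.Tendsto ωs (nhdsWithin 0 (Set.Ioi 0)) (nhds 2) ∧ (∀ᶠ δ in nhdsWithin 0 (Set.Ioi 0), ωs δ < 2) ∧ ∀ (D : Literature.Probability.RandomPlanarGeometry.DobrushinDomain) (a b : ℝ → Literature.Probability.LatticeModels.HexVertex), Literature.Probability.RandomPlanarGeometry.SAW.IsEmbEndpointApprox Literature.Probability.LatticeModels.hexGraph Literature.Probability.LatticeModels.hexCenter D a b → Literature.Probability.RandomPlanarGeometry.TendstoLaw (fun δ (γ : Literature.Probability.RandomPlanarGeometry.SAW.HexDomainSAW D.carrier δ (a δ) (b δ)) => γ.curve) (fun δ => isawLaw D.carrier δ (xs δ) (ωs δ) (a δ) (b δ)) id (P D)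

/-- item stmt-CriticalPhenomena-17997 · crux · rank 4 · open · by planner
why it might fail: universality along a critical line with no monotone coupling in ω: an intermediate multicritical point on (1,2), a first-order piece of x_c(ω), or non-commuting limits (δ → 0, ω ↑ 2) vs ω ↓ 1 would break the propagation; no rigorous irrelevance argument exists at a non-Gaussian fixed point.
sources: DuplantierSaleur1987, BloteNienhuis1989, VernierJacobsenSaleur2015, DuminilCopinKozmaYadin2014, GlazmanManolescu2019
[crux] NO TRANSITION BELOW Θ′: if along some schedule ω(δ) ↑ 2, x(δ) the contact-fugacity interfaces
converge to chordal SLE_{8/3} in every Dobrushin domain, then OneClassBelowTheta holds — the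
SLE_{8/3} limit propagates from the window to every fixed contact fugacity ω ∈ [1,2) along the
critical curve, down to the SAW at (1/√(2+√2), 1) (irrelevance of the contact operator at the dilute
fixed point: Cov_ω(macroscopic event, K − c(ω)V) → 0 for ω < 2). [deps: ThetaWindowLimit]
[difficulty: XL] -/
@[route_item "route-CriticalPhenomena-SAWThetaPercolation", crux]
def BelowThetaContinuity : Prop :=
  let isawLaw : (Ω : Set ℂ) → (δ x ω : ℝ) → (a b : Literature.Probability.LatticeModels.HexVertex) → MeasureTheory.Measure (Literature.Probability.RandomPlanarGeometry.SAW.HexDomainSAW Ω δ a b) := fun Ω δ x ω a b => let w : MeasureTheory.Measure (Literature.Probability.RandomPlanarGeometry.SAW.HexDomainSAW Ω δ a b) := MeasureTheory.Measure.sum (fun γ : Literature.Probability.RandomPlanarGeometry.SAW.HexDomainSAW Ω δ a b => ENNReal.ofReal (x ^ γ.vertexCount * ω ^ (γ.vertexCount - (γ.walk.darts.toFinset.biUnion (fun d => Literature.Probability.LatticeModels.hexFaceVertices d.fst ∩ Literature.Probability.LatticeModels.hexFaceVertices d.snd)).card)) • MeasureTheory.Measure.dirac γ); (w Set.univ)⁻¹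 • w; (∃ ωs xs : ℝ → ℝ, Filter.Tendsto ωs (nhdsWithin 0 (Set.Ioi 0)) (nhds 2) ∧ (∀ᶠ δ in nhdsWithin 0 (Set.Ioi 0), ωs δ < 2) ∧ ∀ (D : Literature.Probability.RandomPlanarGeometry.DobrushinDomain) (a b : ℝ → Literature.Probability.LatticeModels.HexVertex), Literature.Probability.RandomPlanarGeometry.SAW.IsEmbEndpointApprox Literature.Probability.LatticeModels.hexGraph Literature.Probability.LatticeModels.hexCenter D a b → Literature.Probability.RandomPlanarGeometry.ConvergesInLawToSLE ((8 : NNReal) / 3) D (fun δ (γ : Literature.Probability.RandomPlanarGeometry.SAW.HexDomainSAW D.carrier δ (a δ) (b δ)) => γ.curve) (fun δ => isawLaw D.carrier δ (xs δ) (ωs δ) (a δ) (b δ))) → OneClassBelowTheta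

/-- item stmt-CriticalPhenomena-0807 · crux · rank 5 · open · by planner
why it might fail: universality across lattices for the SAW is open even at the level of exponents; Yang–Baxter track exchange (Glazman–Manolescu) controls boundary two-point functions only, not curve laws.
sources: GlazmanManolescu2019, DuminilCopinSmirnov2012, LawlerSchrammWerner2004SAW
[crux] r2 (hardest, most informative; informal until defn HexSAWLaw lands): lattice universality of
the chordal critical SAW law — for every Dobrushin domain (Ω; a, b), every square-lattice endpoint
approximation (a_δ, b_δ) (Literature.Probability.RandomPlanarGeometry.SAW.IsEndpointApprox) and
every hexagonal-lattice endpoint approximation (a'_δ, b'_δ), and every bounded continuous f on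
CurveClass ℂ: ∫ f∘curve dP^{Z^2}_{x_c(Z^2),δ} − ∫ f∘curve dP^{Hex}_{x_c(Hex),δ} → 0 as δ → 0+
(x_c(Hex) = 1/√(2+√2), Duminil-Copin–Smirnov 2012 Thm 1). Tool: Yang–Baxter track exchange on
rhombic tilings (Glazman–Manolescu arXiv:1708.00395 §3), which so far controls boundary two-point
functions, not curve laws. -/
@[route_item "route-CriticalPhenomena-SAWThetaPercolation", crux]
def LatticeUniversality : Prop :=
  ∀ (D : Literature.Probability.RandomPlanarGeometry.DobrushinDomain) (a b : ℝ → Literature.Probability.LatticeModels.Site 2) (a' b' : ℝ → Literature.Probability.LatticeModels.HexVertex), Literature.Probability.RandomPlanarGeometry.SAW.IsEndpointApprox D a b → Literature.Probability.RandomPlanarGeometry.SAW.IsEmbEndpointApprox Literature.Probability.LatticeModels.hexGraph Literature.Probability.LatticeModels.hexCenter D a' b' → ∀ f : BoundedContinuousFunction (Literature.Probability.RandomPlanarGeometry.CurveClass ℂ) ℝ, Filter.Tendsto (fun δ => (∫ γ, f γ.curve ∂(Literature.Probability.RandomPlanarGeometry.SAW.law D.carrier δ (a δ) (b δ))) - ∫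 γ, f γ.curve ∂(Literature.Probability.RandomPlanarGeometry.SAW.hexSAWLaw D.carrier δ (a' δ) (b' δ))) (nhdsWithin 0 (Set.Ioi 0)) (nhds 0)

-- earlier Assembly (stmt-CriticalPhenomena-17999, replaced 2026-08-17T10:19:47Z -> stmt-CriticalPhenomena-18021): retired by None — PinchFreeSLE6 → ThetaWindowLimit → BelowThetaContinuity → HexEndpointApproxExists → LatticeUniversality → SAWScalingLimit
-- earlier Assembly (stmt-CriticalPhenomena-18021, replaced 2026-08-17T10:59:36Z -> stmt-CriticalPhenomena-18043): retired by None — PinchFreeSLE6 → ThetaWindowLimit → BelowThetaContinuity → LatticeUniversality → SAWScalingLimit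
/-- item stmt-CriticalPhenomena-18043 · assembly · rank 1 · open · by planner
sources: LawlerSchrammWerner2003Restriction, DuminilCopinSmirnov2012, DuplantierSaleur1987
[assembly] the route frame statement target ⇒ Statement: OneClassBelowTheta → LatticeUniversality →
SAWScalingLimit — a HYPOTHESIS of the deciding theorem `closes` (which itself derives the target
OneClassBelowTheta from the three cruxes PinchFreeSLE6, ThetaWindowLimit, BelowThetaContinuity by
bookkeeping: tendsto_nhds_unique identifies the window limit with the SLE(8/3) law) and an open
PROVABLE-NOW item: at ω = 1 the contact-fugacity law is hexSAWLaw (one_pow/mul_one, xc 1 = x_c(ℍ));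
hexagonal companion endpoints exist for every Dobrushin domain (landed
Theorems.HexEndpointApprox.exists_isEmbEndpointApprox); LatticeUniversality + Tendsto.add transfer
the limit to SAW.law on δℤ² (two-ε). Hand-off proof: route evidence AssemblyProof.lean (lean check
rc 0, 0 sorries). [difficulty: provable-now] -/
@[route_item "route-CriticalPhenomena-SAWThetaPercolation"]
def Assembly : Prop :=
  OneClassBelowTheta → LatticeUniversality → SAWScalingLimit

/-! D-0027 §2.1 — DECIDING THEOREM (planner-authored via `route open/edit --closes-file`; by planner-rbadge-CriticalPhenomena-SAWThetaPerco-1cff4865-g9-0 2026-08-17T18:16:13Z):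
its hypotheses are this route's items and its conclusion the sub-problem Statement (glue_lint), and it elaborates with this file. -/

@[closes "route-CriticalPhenomena-SAWThetaPercolation"] theorem closes (hPinch : PinchFreeSLE6) (hWindow : ThetaWindowLimit) (hBelow : BelowThetaContinuity)
    (hLattice : LatticeUniversality) : _root_.SAWScalingLimit := by
  -- CRUX-ONLY deciding theorem (route-repair g9 re-certification, 2026-08-17): the four binders are the four cruxes;
  -- the target `OneClassBelowTheta` and the assembly item `Assembly` are DERIVED inside this proof (both decls occur
  -- in the proof term, hence both lie in the cone of `closes`; nothing is assumed beyond the cruxes).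
  -- Step 1 (cruxes ⇒ target). In every Dobrushin domain the ε-conditioned SLE₆ laws converge both to the window
  -- limit `P D` (ThetaWindowLimit) and to the law of an SLE(8/3) curve `Γ` (PinchFreeSLE6); limits along `𝓝[>] 0`
  -- are unique test function by test function (`tendsto_nhds_unique`), so the near-Θ′ window laws converge in law
  -- to SLE(8/3), and BelowThetaContinuity propagates this to every contact fugacity ω ∈ [1,2): OneClassBelowTheta.
  have hTarget : OneClassBelowTheta := by
    refine hBelow ?_
    obtain ⟨P, hP, ωs, xs, hω, hlt, hwin⟩ := hWindow
    refine ⟨ωs, xs, hω, hlt, fun D a b hab => ?_⟩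
    obtain ⟨μ, hμ, hεP⟩ := hP D
    obtain ⟨Γ, hΓ, -, hεΓ⟩ := hPinch D μ hμ
    refine ⟨Γ, hΓ, Filter.Eventually.of_forall fun δ =>
      (Literature.Probability.RandomPlanarGeometry.SAW.EmbDomainSAW.measurable_of_top _).aemeasurable,
      fun f => ?_⟩
    rw [← tendsto_nhds_unique (hεP f) (hεΓ f)]
    exact hwin D a b hab f
  -- Step 2 (the assembly item `Assembly : OneClassBelowTheta → LatticeUniversality → SAWScalingLimit`, proved here).
  -- At ω = 1 the contact-fugacity law IS the critical hexagonal SAW law (`one_pow`, `mul_one`, `xc 1 = x_c(ℍ)`);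
  -- hexagonal companion endpoints exist for every Dobrushin domain (landed
  -- `Theorems.HexEndpointApprox.exists_isEmbEndpointApprox`); LatticeUniversality + `Tendsto.add` move the SLE(8/3)
  -- limit from δℍ to δℤ² test function by test function (`sub_add_cancel`, `zero_add`).
  have hAssembly : Assembly := by
    intro hT hLU D a b hab
    obtain ⟨xc, hxc, hall⟩ := hT
    obtain ⟨a', b', hab'⟩ :=
      Summit.CriticalPhenomena.SAWScalingLimit.Theorems.HexEndpointApprox.exists_isEmbEndpointApprox D
    obtain ⟨Γ, hΓ, -, hTL⟩ := hall 1 ⟨le_rfl, by norm_num⟩ D a' b' hab'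
    refine ⟨Γ, hΓ, Filter.Eventually.of_forall fun δ =>
      (Literature.Probability.RandomPlanarGeometry.SAW.DomainSAW.measurable_of_top _).aemeasurable,
      fun f => ?_⟩
    -- the ω = 1 member of the contact-fugacity family is `hexSAWLaw`
    have hHex : Filter.Tendsto
        (fun δ => ∫ γ, f γ.curve ∂(Literature.Probability.RandomPlanarGeometry.SAW.hexSAWLaw D.carrier δ (a' δ) (b' δ)))
        (nhdsWithin 0 (Set.Ioi 0)) (nhds (∫ ω, f (Γ ω) ∂Literature.Probability.Process.preWienerMeasure)) := by
      refine Filter.Tendsto.congr (fun δ => ?_) (hTL f)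
      congr 1
      simp only [one_pow, mul_one, hxc]
      rfl
    simpa only [sub_add_cancel, zero_add] using (hLU D a b a' b' hab hab' f).add hHex
  exact hAssembly hTarget hLattice

end Summit.CriticalPhenomena.SAWScalingLimit.Theses.SAWThetaPercolation
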